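import Mathlib
import HarnessLib
import Literature.Analysis.FluidPDE.SelfSimilar
import Literature.Analysis.FluidPDE.LocalTypeI
import Literature.Analysis.FluidPDE.VectorCalculus
import Literature.Analysis.FluidPDE.CurlIsometryCovariance
import Literature.Analysis.UnboundedOperators.HeatKernel
import Summits.NavierStokesRegularity.NavierStokesRegularity.Theorems.LocalSineTubeDoorProfileAlignedWindowRigidityAncient
import Summits.NavierStokesRegularity.NavierStokesRegularity.Theorems.RellichScarSimilarityCovarianceRotationTypeI
import Summits.NavierStokesRegularity.NavierStokesRegularity.Theorems.PoloidalWindowDoorPoloidalWindowRigidityWindow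
import Summits.NavierStokesRegularity.NavierStokesRegularity.Theorems.PoloidalWindowDoorPoloidalWindowRigidityRotate
import Summits.NavierStokesRegularity.NavierStokesRegularity.Theorems.PoloidalWindowDoorPoloidalWindowRigidityFlat

/-!
# Route `LocalVelCompTubeDoor` (S10, STAGED by nsreg-p1 g9, not born), crux K2′ `VelCompWindowRigidity` — three of the
# four birth-skeleton stubs (`stub_windowToEverywhere`, `stub_rotate`, `stub_shearTrivial`) over the class hypotheses

Cell ns-regularity-ideate, seat p6 (route-directed support; SPECULATIVE staging — lands `--supports <K2′ item>` only if the
route is born). The skeleton (`route-velcomp/bc/VelCompWindowRigidity_birth.lean`) bundles the four class clauses as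
`ProfileHyp C v`; here they are carried unbundled (as in every `PoloidalWindowDoor…` support file), so the birth-time stub
files are one-liners `fun C v ⟨hrate, hcont, hmild, hdiv⟩ … => …`:

* `velComp_windowToEverywhere` — STUB 1: a velocity component `⟪v(s), e⟫` vanishing on a nonempty open set of a slice
  vanishes on the whole slice (slice real-analyticity `…Ancient.analyticOnNhd_slice` + `…Window.inner_eq_zero_spread`);
* `velComp_rotate` — STUB 2: WLOG `e = e₃`: conjugating by a linear isometry `L` with `L⁻¹e₃ = e/‖e‖`
  (`…Rotate.class_conj_linearIsometryEquiv`, `…Rotate.exists_linearIsometryEquiv_symm_single_two`) keeps the class and the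
  singular apex and gives `v′₃ ≡ 0`;
* `velComp_shearTrivial` — STUB 4: `v₃ ≡ 0` and `ω₃ ≡ 0` ⇒ not backward-singular — a COROLLARY of the poloidal flat
  stratum `…Flat.stub_flatStratum` (`v₃ ≡ 0` makes `v·e₃` flat in the direction `e₀`).

STUB 3 (`stub_ertelCollapse`: `v₃ ≡ 0 ⇒ ω₃ ≡ 0`, KNSS Lemma 2.1 at `ℝ³` + a flux bound) is the one analytic piece and is NOT
attempted here.

WHAT THIS IS NOT: not a claim about Navier–Stokes regularity; support lemmas for a STAGED (unborn) door route of LADDER-NS N0.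
-/

noncomputable section

-- the summit and its single sub-problem share the name (CONVENTIONS §1), as in every Theorems file
set_option linter.dupNamespace false

namespace Summit.NavierStokesRegularity.NavierStokesRegularity.Theorems.LocalVelCompTubeDoorVelCompWindowRigiditySupport

open MeasureTheory Set Function Filter Topology TopologicalSpace Metric
open scoped RealInnerProductSpace InnerProductSpace
open Literature.Analysis Literature.Analysis.FluidPDE
open Summit.NavierStokesRegularity.NavierStokesRegularity.Theorems.LocalSineTubeDoorProfileAlignedWindowRigidityAncient
open Summit.NavierStokesRegularity.NavierStokesRegularity.Theorems.RellichScarSimilarityCovariance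
open Summit.NavierStokesRegularity.NavierStokesRegularity.Theorems.PoloidalWindowDoorPoloidalWindowRigidityWindow
open Summit.NavierStokesRegularity.NavierStokesRegularity.Theorems.PoloidalWindowDoorPoloidalWindowRigidityRotate
open Summit.NavierStokesRegularity.NavierStokesRegularity.Theorems.PoloidalWindowDoorPoloidalWindowRigidityFlat

variable {C : ℝ} {v : ℝ → EuclideanSpace ℝ (Fin 3) → EuclideanSpace ℝ (Fin 3)}

/-- **STUB 1 of K2′ — window ⇒ everywhere for a velocity component.** Slices of a profile of the class are real-analytic,
so `⟪v(s,·), e⟫` vanishing on a nonempty open set of every slice vanishes identically on every slice. -/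
theorem velComp_windowToEverywhere (hrate : HasTypeITimeDecay C v)
    (hcont : ContinuousOn (uncurry v) (Iio (0 : ℝ) ×ˢ univ))
    (hmild : ∀ s t : ℝ, s < t → t < 0 → ∀ x,
      v t x = UnboundedOperators.heatExtension (v s) (t - s) x - oseenDuhamel 1 s v v t x)
    (e : EuclideanSpace ℝ (Fin 3))
    (hwin : ∀ s < 0, ∃ U : Set (EuclideanSpace ℝ (Fin 3)), IsOpen U ∧ U.Nonempty ∧ ∀ y ∈ U, inner ℝ (v s y) e = 0) :
    ∀ s < 0, ∀ y, inner ℝ (v s y) e = 0 := by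
  intro s hs
  obtain ⟨U, hU, hne, hUz⟩ := hwin s hs
  exact inner_eq_zero_spread (analyticOnNhd_slice hcont (bdd_of_hasTypeITimeDecay hrate) hmild hs) e hU hne hUz

/-- **STUB 2 of K2′ — WLOG `e = e₃`.** A backward-singular profile of the class with `⟪v, e⟫ ≡ 0` (`e ≠ 0`) yields, by
conjugation with a linear isometry `L` of `ℝ³` with `L⁻¹e₃ = e/‖e‖`, a backward-singular profile of the class whose third
component vanishes identically (`(L v(s, L⁻¹y))₃ = ⟪v(s, L⁻¹y), L⁻¹e₃⟫ = ‖e‖⁻¹⟪v(s, L⁻¹y), e⟫ = 0`). -/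
theorem velComp_rotate (hrate : HasTypeITimeDecay C v)
    (hcont : ContinuousOn (uncurry v) (Iio (0 : ℝ) ×ˢ univ))
    (hmild : ∀ s t : ℝ, s < t → t < 0 → ∀ x,
      v t x = UnboundedOperators.heatExtension (v s) (t - s) x - oseenDuhamel 1 s v v t x)
    (hdiv : ∀ t < 0, VectorCalculus.IsDivFree (v t)) (hsing : IsBackwardSingularPoint v 0)
    {e : EuclideanSpace ℝ (Fin 3)} (he : e ≠ 0) (hcomp : ∀ s < 0, ∀ y, inner ℝ (v s y) e = 0) :
    ∃ (C' : ℝ) (v' : ℝ → EuclideanSpace ℝ (Fin 3) → EuclideanSpace ℝ (Fin 3)),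
      (HasTypeITimeDecay C' v' ∧ ContinuousOn (uncurry v') (Iio (0 : ℝ) ×ˢ univ) ∧
        (∀ s t : ℝ, s < t → t < 0 → ∀ x,
          v' t x = UnboundedOperators.heatExtension (v' s) (t - s) x - oseenDuhamel 1 s v' v' t x) ∧
        (∀ t < 0, VectorCalculus.IsDivFree (v' t))) ∧
      IsBackwardSingularPoint v' 0 ∧ ∀ s < 0, ∀ y, v' s y 2 = 0 := by
  obtain ⟨L, hL⟩ := exists_linearIsometryEquiv_symm_single_two he
  obtain ⟨hrate', hcont', hmild', hdiv'⟩ := class_conj_linearIsometryEquiv L hrate hcont hmild hdiv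
  refine ⟨C, fun t x => L (v t (L.symm x)), ⟨hrate', hcont', hmild', hdiv'⟩, isBackwardSingularPoint_zero_conj L hsing,
    fun s hs y => ?_⟩
  have h1 : (L (v s (L.symm y))) 2 = inner ℝ (L (v s (L.symm y))) (EuclideanSpace.single 2 (1 : ℝ)) := by
    simp [EuclideanSpace.inner_single_right]
  show (L (v s (L.symm y))) 2 = 0
  rw [h1, ← LinearIsometryEquiv.inner_map_map L.symm, LinearIsometryEquiv.symm_apply_apply, hL, inner_smul_right,
    hcomp s hs (L.symm y), mul_zero]

/-- **STUB 4 of K2′ — shear triviality.** A profile of the class with `v₃ ≡ 0` and `ω₃ ≡ 0` is not backward-singular: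
`v₃ ≡ 0` makes `v·e₃` flat in the horizontal direction `e₀`, and `ω₃ ≡ 0` makes the profile poloidal along `e₃`, so the
poloidal flat stratum `…Flat.stub_flatStratum` applies. -/
theorem velComp_shearTrivial (hrate : HasTypeITimeDecay C v)
    (hcont : ContinuousOn (uncurry v) (Iio (0 : ℝ) ×ˢ univ))
    (hmild : ∀ s t : ℝ, s < t → t < 0 → ∀ x,
      v t x = UnboundedOperators.heatExtension (v s) (t - s) x - oseenDuhamel 1 s v v t x)
    (hdiv : ∀ t < 0, VectorCalculus.IsDivFree (v t))
    (h3 : ∀ s < 0, ∀ y, v s y 2 = 0) (hω3 : ∀ s < 0, ∀ y, curl (v s) y 2 = 0) :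
    ¬ IsBackwardSingularPoint v 0 := by
  refine stub_flatStratum C v hrate hcont hmild hdiv (fun s hs y => ?_) (fun s hs y => ?_)
  · simp [EuclideanSpace.inner_single_right, hω3 s hs y]
  · have hd : DifferentiableAt ℝ (v s) y :=
      ((analyticOnNhd_slice hcont (bdd_of_hasTypeITimeDecay hrate) hmild hs) y (mem_univ _)).differentiableAt
    rw [PoloidalWindowDoorPoloidalWindowRigidityFlat.fderiv_apply_coord hd]
    have hz : (fun w => v s w 2) = fun _ => (0 : ℝ) := funext fun w => h3 s hs w
    rw [hz]
    simp

end Summit.NavierStokesRegularity.NavierStokesRegularity.Theorems.LocalVelCompTubeDoorVelCompWindowRigiditySupport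

end
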